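import Summits.BirchSwinnertonDyer.Rank1Residual.ManinAdditive.DegeneracyClassEulerLaws
import HarnessLib
import HarnessLib.Audit.Tags

/-!
# THEOREM U♮E (es g22, PROVED): Euler-translated prime-class degeneracy loops of plus index prime to `3` give a tame
# even unit twist WITH the full Euler factor of the sharp primes (cell `bsd-f2-manin`, T-es-29 (h)(h′), typer g15)

Cell `bsd-f2-manin` (D-0131 (3) frontier), lens es, planner es g22 MEMO-es §36.14/§36.15 («PROVED (3)/(4)» 2026-08-28T20:38Z /
20:52Z); landed by the cell typer g15 VERBATIM from HOME/es/Sketch-es-g22-thm87.lean sha16 1fa952104aa82908: the generic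
FOURIER UNIT LEMMA FOR A FAMILY `exists_unit_of_fourier_family` (§E, file lines 1043–1112; `T χ` arbitrary, e.g.
`E(χ)·S_χ` — the verbatim generalisation of the tree's `KatoCurve.exists_unitTwist_of_fourier`), the character-side identities
of §EL `weightChar_mul_eulerFactorTwist` / `weightChar_mul_eulerFactorList` («`(Σ_x w(x)χ(x⁻¹))·E_L(χ) = Σ_x (θ_L w)(x)χ(x⁻¹)`»)
and `sum_weightChar_mul_twistedSymbolSum` (weighted orthogonality; lines 1482–1556), and **THEOREM U♮E_L**
`exists_prime_eulerListUnitTwist_of_degeneracyClass` (lines 1634–1792): for a rational newform `f`, if the E-translated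
prime-class degeneracy loops of ratio `t` for a LIST `L` of sharp primes (tree `KatoCurve.degeneracyLoopsClassTwoEulerList`,
leaf `DegeneracyClassEulerLaws`) have plus index prime to `3`, there is a prime `ℓ ≡ 2 (mod 3)`, `ℓ ∤ tN`, `ℓ ∤ q (q ∈ L)`, an
even primitive `χ ≠ 1` mod `ℓ` with `3 ∤ ord χ`, `χ(t̄) ≠ 1` and `E_L(χ)·S_χ = r·Ω⁺_f` with `s·r/3 ∉ ℤ̄` for all `s ⊥ 3` —
the Euler factor INCLUDED (no norm / Galois step, no hand exclusion of «E-hole» characters).  Namespace `BsdF2ManinEsG22T` ↦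
`…ManinAdditive.KatoCurve`; `ℤ̄ ∩ ℚ = ℤ` is the tree's `Literature.RingTheory.ZeroDimensional.exists_int_of_isIntegral_ratCast`
(reused, as in `TwistedSymbolFourier`).  NOT LANDED from §E: the one-sharp-prime THEOREM U♮E₁
`exists_prime_eulerUnitTwist_of_degeneracyClass` and `sum_char_inv_mul_euler_twistedSymbolSum` (es: subsumed by the list
version for the route's purpose, TURNKEY-es-18 supersedes -17; land on request).

EVERYTHING HERE IS A SORRY-FREE THEOREM (no law, no fact; hypotheses `IsNewform0 f`, `coeffField f = ⊥`,
`DegeneracyClassEulerListPlusIndexPrimeTo f 3 t L a`).  Consumers: `DegeneracyClassEulerWitnesses.lean` (W-level: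
`ThreeAdicPolarWitness W W D.f` at EVERY level `9 ∣ N` from the law E-es-93; TURNKEY-es-18/19, C3 LEAD) and
`DegeneracyClassEulerUnitTwistConverse.lean` (LEMMA C).  BC7 summit-mode probes CLEAN (es/g22/g22-bc7g.raw.txt 14/14).
REF1 R-es-44 scope (§E/§EL) PENDING at filing — a finding is repaired under a NEW name (append-only).
bears_on: stmt-BirchSwinnertonDyer-22968.  PARTITION 0 (a theorem about a named hypothesis) · beyond-print theorem: es says YES
(lemma-level; nearest print Stevens 1985 / Ash–Stevens 1986, es MEMO-es §36.8) · BSD is not proved by this; Manin's conjecture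
is not proved by this.
-/

noncomputable section

open scoped Classical MatrixGroups ModularForm ComplexConjugate

open CongruenceSubgroup Complex Literature.NumberTheory.EllipticCurves
  Literature.NumberTheory.EllipticCurves.ModularForms
open Summit.BirchSwinnertonDyer.Rank1Residual.ManinAdditive.KatoCurve
open Summit.BirchSwinnertonDyer.Rank1Residual.ManinAdditive.Gamma1Lattice

namespace Summit.BirchSwinnertonDyer.Rank1Residual.ManinAdditive.KatoCurve

section EulerUnitTwist

variable {N : ℕ} (f : CuspForm (Gamma0 N) 2)

/-- **Fourier unit lemma for an arbitrary family** `T χ` (e.g. `E(χ)·S_χ`): VERBATIM generalisation of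
`exists_unitTwist_of_fourier` (`twistedSymbolSum f χ ↦ T χ`). -/
theorem exists_unit_of_fourier_family [NeZero N] {ℓ : ℕ} [NeZero ℓ] (h3tot : ¬ (3 : ℤ) ∣ (ℓ.totient : ℤ))
    (hΩC : (plusPeriod f : ℂ) ≠ 0) (T : DirichletCharacter ℂ ℓ → ℂ) (P : DirichletCharacter ℂ ℓ → Prop)
    (c : DirichletCharacter ℂ ℓ → ℂ)
    (hcI : ∀ χ, P χ → IsIntegral ℤ (c χ)) (hc0 : ∀ χ, ¬ P χ → c χ = 0) {j : ℤ} (hj3 : ¬ (3 : ℤ) ∣ j)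
    (hE : (ℓ.totient : ℂ) * ((j : ℂ) * (plusPeriod f : ℂ)) = ∑ χ : DirichletCharacter ℂ ℓ, c χ * T χ) :
    ∃ χ : DirichletCharacter ℂ ℓ, P χ ∧
      ∀ s : ℕ, ¬ 3 ∣ s → ¬ IsIntegral ℤ ((s : ℂ) * (T χ / (plusPeriod f : ℂ)) / 3) := by
  classical
  by_contra hnone
  push Not at hnone
  choose! sf hsf3 hsfint using hnone
  set sfun : DirichletCharacter ℂ ℓ → ℕ := fun χ => if P χ then sf χ else 1 with hsfun
  have hsfun3 : ∀ χ, ¬ 3 ∣ sfun χ := by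
    intro χ
    show ¬ 3 ∣ (if P χ then sf χ else 1)
    by_cases h : P χ
    · rw [if_pos h]; exact hsf3 χ h
    · rw [if_neg h]; decide
  set s : ℕ := ∏ χ, sfun χ with hsdef
  have hs3 : ¬ 3 ∣ s := by
    rw [hsdef]
    intro h
    obtain ⟨χ, -, hχ⟩ := (Prime.dvd_finsetProd_iff Nat.prime_three.prime _).mp h
    exact hsfun3 χ hχ
  have hint : ∀ χ : DirichletCharacter ℂ ℓ, P χ →
      IsIntegral ℤ ((s : ℂ) * (T χ / (plusPeriod f : ℂ)) / 3) := by
    intro χ hP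
    have hsplit : s = sfun χ * ∏ χ' ∈ Finset.univ.erase χ, sfun χ' := by
      rw [hsdef, ← Finset.mul_prod_erase _ _ (Finset.mem_univ χ)]
    have hsfχ : sfun χ = sf χ := by
      show (if P χ then sf χ else 1) = sf χ
      rw [if_pos hP]
    rw [hsplit]
    push_cast
    have : ((sf χ : ℂ) * ∏ χ' ∈ Finset.univ.erase χ, (sfun χ' : ℂ)) *
        (T χ / (plusPeriod f : ℂ)) / 3
        = (∏ χ' ∈ Finset.univ.erase χ, (sfun χ' : ℂ)) *
          ((sf χ : ℂ) * (T χ / (plusPeriod f : ℂ)) / 3) := by ring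
    rw [hsfχ, this]
    refine IsIntegral.mul ?_ (hsfint χ hP)
    refine IsIntegral.prod _ (fun χ' _ => ?_)
    exact_mod_cast isIntegral_algebraMap (R := ℤ) (A := ℂ) (x := (sfun χ' : ℤ))
  have hq : (((((ℓ.totient : ℤ) * j * s : ℤ) : ℚ) / 3 : ℚ) : ℂ)
      = ∑ χ : DirichletCharacter ℂ ℓ, c χ * ((s : ℂ) * (T χ / (plusPeriod f : ℂ)) / 3) := by
    have : ∑ χ : DirichletCharacter ℂ ℓ, c χ * ((s : ℂ) * (T χ / (plusPeriod f : ℂ)) / 3)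
        = (∑ χ : DirichletCharacter ℂ ℓ, c χ * T χ) * ((s : ℂ) / (3 * (plusPeriod f : ℂ))) := by
      rw [Finset.sum_mul]
      refine Finset.sum_congr rfl (fun χ _ => ?_)
      field_simp
    rw [this, ← hE]
    push_cast
    field_simp
  have hI : IsIntegral ℤ (((((ℓ.totient : ℤ) * j * s : ℤ) : ℚ) / 3 : ℚ) : ℂ) := by
    rw [hq]
    refine IsIntegral.sum _ (fun χ _ => ?_)
    by_cases hP : P χ
    · exact (hcI χ hP).mul (hint χ hP)
    · rw [hc0 χ hP, zero_mul]; exact isIntegral_zero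
  obtain ⟨y, hy⟩ := Literature.RingTheory.ZeroDimensional.exists_int_of_isIntegral_ratCast hI
  have h3 : (3 : ℤ) ∣ (ℓ.totient : ℤ) * j * s := by
    refine ⟨y, ?_⟩
    have : ((y : ℚ)) * 3 = (((ℓ.totient : ℤ) * j * s : ℤ) : ℚ) := by rw [hy]; field_simp
    exact_mod_cast (by linarith : (((ℓ.totient : ℤ) * j * s : ℤ) : ℚ) = 3 * y)
  rcases Int.prime_three.dvd_mul.mp h3 with h | h
  · rcases Int.prime_three.dvd_mul.mp h with h' | h'
    · exact h3tot h'
    · exact hj3 h'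
  · exact hs3 (Int.natCast_dvd_natCast.mp h)

/-- Character side, one prime: `(Σ_x w(x)χ(x⁻¹))·E_q(χ) = Σ_x (θ_q w)(x) χ(x⁻¹)`. -/
theorem weightChar_mul_eulerFactorTwist {m : ℕ} [Fact m.Prime] (q : ℕ) (a : ℤ)
    (w : ZMod m → ℤ) (hq : ((q : ℕ) : ZMod m) ≠ 0) (χ : DirichletCharacter ℂ m) :
    (∑ x : ZMod m, (w x : ℂ) * χ x⁻¹) * eulerFactorTwist q a χ
      = ∑ x : ZMod m, ((eulerShift q a w x : ℤ) : ℂ) * χ x⁻¹ := by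
  haveI : NeZero m := ⟨(Fact.out : m.Prime).ne_zero⟩
  set lam : ZMod m := ((q : ℕ) : ZMod m) with hlamdef
  have hmul : χ lam * χ lam⁻¹ = 1 := by rw [← map_mul, mul_inv_cancel₀ hq, map_one]
  have hne : χ lam ≠ 0 := left_ne_zero_of_mul_eq_one hmul
  have hinv : χ lam⁻¹ = (χ lam)⁻¹ := eq_inv_of_mul_eq_one_right hmul
  -- reindexed sums
  have r1 : ∑ x : ZMod m, (w x : ℂ) * χ x⁻¹ * χ lam = ∑ y : ZMod m, (w (y * lam) : ℂ) * χ y⁻¹ := by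
    rw [← sum_reindex_mul (fun x => (w x : ℂ) * χ x⁻¹ * χ lam) hq]
    refine Finset.sum_congr rfl (fun y _ => ?_)
    have : χ (y * lam)⁻¹ * χ lam = χ y⁻¹ := by
      rw [mul_inv, map_mul, mul_assoc, ← map_mul, inv_mul_cancel₀ hq, map_one, mul_one]
    rw [mul_assoc, this]
  have r2 : ∑ x : ZMod m, (w x : ℂ) * χ x⁻¹ * (χ lam)⁻¹
      = ∑ y : ZMod m, (w (y * lam⁻¹) : ℂ) * χ y⁻¹ := by
    rw [← sum_reindex_mul (fun x => (w x : ℂ) * χ x⁻¹ * (χ lam)⁻¹) (inv_ne_zero hq)]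
    refine Finset.sum_congr rfl (fun y _ => ?_)
    have : χ (y * lam⁻¹)⁻¹ * (χ lam)⁻¹ = χ y⁻¹ := by
      rw [mul_inv, inv_inv, map_mul, mul_assoc, mul_inv_cancel₀ hne, mul_one]
    rw [mul_assoc, this]
  have hE : eulerFactorTwist q a χ
      = ((q : ℂ) ^ 2 + (a : ℂ) ^ 2) - (a : ℂ) * (q : ℂ) * (χ lam + (χ lam)⁻¹) := by
    unfold eulerFactorTwist
    rw [← hlamdef]
    field_simp
    ring
  have r1' : (∑ x : ZMod m, (w x : ℂ) * χ x⁻¹) * χ lam = ∑ y : ZMod m, (w (y * lam) : ℂ) * χ y⁻¹ := by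
    rw [Finset.sum_mul]; exact r1
  have r2' : (∑ x : ZMod m, (w x : ℂ) * χ x⁻¹) * (χ lam)⁻¹
      = ∑ y : ZMod m, (w (y * lam⁻¹) : ℂ) * χ y⁻¹ := by
    rw [Finset.sum_mul]; exact r2
  have rhs : ∑ x : ZMod m, ((eulerShift q a w x : ℤ) : ℂ) * χ x⁻¹
      = ∑ x : ZMod m, (((q : ℂ) ^ 2 + (a : ℂ) ^ 2) * ((w x : ℂ) * χ x⁻¹)
          - (a : ℂ) * (q : ℂ) * ((w (x * lam) : ℂ) * χ x⁻¹)
          - (a : ℂ) * (q : ℂ) * ((w (x * lam⁻¹) : ℂ) * χ x⁻¹)) := by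
    refine Finset.sum_congr rfl (fun x _ => ?_)
    simp only [eulerShift, ← hlamdef]
    push_cast
    ring
  rw [rhs, Finset.sum_sub_distrib, Finset.sum_sub_distrib, ← Finset.mul_sum, ← Finset.mul_sum,
    ← Finset.mul_sum, ← r1', ← r2', hE]
  ring

/-- Character side, a list of primes. -/
theorem weightChar_mul_eulerFactorList {m : ℕ} [Fact m.Prime] (a : ℕ → ℤ) (χ : DirichletCharacter ℂ m) :
    ∀ (L : List ℕ) (w : ZMod m → ℤ), (∀ q ∈ L, ((q : ℕ) : ZMod m) ≠ 0) →
      (∑ x : ZMod m, (w x : ℂ) * χ x⁻¹) * eulerFactorList a L χ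
        = ∑ x : ZMod m, ((eulerShiftList a L w x : ℤ) : ℂ) * χ x⁻¹
  | [], w, _ => by simp [eulerFactorList, eulerShiftList]
  | q :: L, w, hL => by
      have hq : ((q : ℕ) : ZMod m) ≠ 0 := hL q (by simp)
      have hL' : ∀ q' ∈ L, ((q' : ℕ) : ZMod m) ≠ 0 := fun q' h => hL q' (by simp [h])
      show (∑ x : ZMod m, (w x : ℂ) * χ x⁻¹) * (eulerFactorTwist q (a q) χ * eulerFactorList a L χ)
        = ∑ x : ZMod m, ((eulerShiftList a L (eulerShift q (a q) w) x : ℤ) : ℂ) * χ x⁻¹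
      rw [← mul_assoc, weightChar_mul_eulerFactorTwist q (a q) w hq χ]
      exact weightChar_mul_eulerFactorList a χ L _ hL'

/-- Weighted orthogonality (weights vanishing at `0`). -/
theorem sum_weightChar_mul_twistedSymbolSum [NeZero N] {m : ℕ} [Fact m.Prime] [NeZero m]
    (v : ZMod m → ℤ) (hv0 : v 0 = 0) :
    ∑ χ : DirichletCharacter ℂ m, (∑ x : ZMod m, (v x : ℂ) * χ x⁻¹) * twistedSymbolSum f χ
      = (m.totient : ℂ) * ∑ x : ZMod m, (v x : ℂ) * cuspValue f m x := by
  simp_rw [Finset.sum_mul]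
  rw [Finset.sum_comm, Finset.mul_sum]
  refine Finset.sum_congr rfl (fun x _ => ?_)
  by_cases hx : x = 0
  · subst hx; simp [hv0]
  · have hxu : IsUnit x := isUnit_iff_ne_zero.mpr hx
    simp_rw [mul_assoc]
    rw [← Finset.mul_sum, sum_char_inv_mul_twistedSymbolSum f hxu]
    ring

/-- **THEOREM U♮E_L (f-level, es g22; PROVED).**  E-translated prime-class degeneracy loops of ratio `t` for a
LIST of sharp primes of plus index prime to `3` ⟹ a unit twist WITH the full Euler factor:
`E_L(χ)·S_χ = r·Ω⁺_f`, `s·r/3 ∉ ℤ̄` (`s ⊥ 3`), `χ` even primitive `≠ 1`, `3 ∤ ord χ`, `χ(t̄) ≠ 1`. -/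
theorem exists_prime_eulerListUnitTwist_of_degeneracyClass [NeZero N] (t : ℕ) (L : List ℕ) (a : ℕ → ℤ)
    (hf : IsNewform0 f) (hQ : coeffField f = ⊥) (hd : DegeneracyClassEulerListPlusIndexPrimeTo f 3 t L a) :
    ∃ (ℓ : ℕ) (_ : NeZero ℓ), ℓ.Prime ∧ ℓ % 3 = 2 ∧ ¬ ℓ ∣ t * N ∧ (∀ q ∈ L, ¬ ℓ ∣ q) ∧
      ∃ (χ : DirichletCharacter ℂ ℓ) (r : ℂ),
        ℓ.Coprime (3 * N) ∧ χ.IsPrimitive ∧ χ ≠ 1 ∧ ¬ 3 ∣ orderOf χ ∧ χ (t : ZMod ℓ) ≠ 1 ∧ χ.Even ∧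
        eulerFactorList a L χ * twistedSymbolSum f χ = r * (plusPeriod f : ℂ) ∧
        ∀ s : ℕ, ¬ 3 ∣ s → ¬ _root_.IsIntegral ℤ ((s : ℂ) * r / 3) := by
  have hΩpos : 0 < plusPeriod f := IsNewform0.plusPeriod_pos_holds hf hQ
  have hΩ : plusPeriod f ≠ 0 := hΩpos.ne'
  have hΩC : (plusPeriod f : ℂ) ≠ 0 := by exact_mod_cast hΩ
  obtain ⟨hre, -⟩ := realPeriods_eq_zmultiples_of_plusPeriod_ne_zero f hΩ
  have hreal : ∀ n, (cuspCoeff f n).im = 0 := cuspCoeff_im_eq_zero_of_coeffField_eq_bot hQ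
  set S : Set ℂ := degeneracyLoopsClassTwoEulerList f t L a with hSdef
  have hSΛ : ∀ g ∈ S, g ∈ periodLattice f := fun g hg => degeneracyLoopsClassTwoEulerList_subset f t L a hg
  have hgen : ∃ g ∈ S, ∃ j : ℤ, ¬ (3 : ℤ) ∣ j ∧ g + conj g = (j : ℂ) * (plusPeriod f : ℂ) := by
    by_contra hcon
    push Not at hcon
    have hS : ∀ g ∈ S, ∃ k : ℤ, g + conj g = 3 * (k : ℂ) * (plusPeriod f : ℂ) := by
      intro g hg
      obtain ⟨j, hj⟩ := exists_add_conj_eq_int_mul f hre (hSΛ g hg)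
      have h3j : (3 : ℤ) ∣ j := by
        by_contra h3
        exact hcon g hg j h3 hj
      obtain ⟨k, rfl⟩ := h3j
      exact ⟨k, by rw [hj]; push_cast; ring⟩
    obtain ⟨x₀, hx₀, hx₀tr⟩ := exists_mem_add_conj_eq f hre
    obtain ⟨y, hy, k, hk3, hky⟩ := hd x₀ hx₀
    obtain ⟨k', hk'⟩ := add_conj_mem_three_of_closure hS hy
    have hx₀tr' : x₀ + starRingEnd ℂ x₀ = (plusPeriod f : ℂ) := hx₀tr
    have hk'' : y + starRingEnd ℂ y = 3 * (k' : ℂ) * (plusPeriod f : ℂ) := hk'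
    rw [hx₀tr', hk''] at hky
    have hkk : (k : ℂ) = 3 * (k' : ℂ) := mul_right_cancel₀ hΩC hky
    have hkz : (k : ℤ) = 3 * k' := by exact_mod_cast hkk
    exact hk3 (Int.natCast_dvd_natCast.mp ⟨k', hkz⟩)
  obtain ⟨g, hg, j, hj3, hgj⟩ := hgen
  obtain ⟨ℓ, b, _, hℓp, hℓ3, hℓtN, hℓL, hℓb, rfl⟩ := hg
  haveI : Fact ℓ.Prime := ⟨hℓp⟩
  have hℓN : ¬ ℓ ∣ N := fun h => hℓtN (Dvd.dvd.mul_left h t)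
  have hℓt : ¬ ℓ ∣ t := fun h => hℓtN (Dvd.dvd.mul_right h N)
  have h3ℓ : ¬ (3 : ℤ) ∣ (ℓ : ℤ) - 1 := by omega
  have h3tot : ¬ (3 : ℤ) ∣ (ℓ.totient : ℤ) := by
    rw [Nat.totient_prime hℓp, Nat.cast_sub hℓp.one_lt.le]; push_cast; exact h3ℓ
  have hcop : ℓ.Coprime (3 * N) := by
    rw [Nat.Prime.coprime_iff_not_dvd hℓp]
    intro hd'
    rcases (Nat.Prime.dvd_mul hℓp).mp hd' with h | h
    · have : ℓ = 3 := (Nat.prime_dvd_prime_iff_eq hℓp Nat.prime_three).mp h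
      omega
    · exact hℓN h
  have hLne : ∀ q ∈ L, ((q : ℕ) : ZMod ℓ) ≠ 0 :=
    fun q hq h => hℓL q hq ((ZMod.natCast_eq_zero_iff q ℓ).mp h)
  set u : ZMod ℓ := ((b : ℕ) : ZMod ℓ) with hudef
  have hu : IsUnit u := (ZMod.isUnit_iff_coprime b ℓ).mpr ((Nat.Prime.coprime_iff_not_dvd hℓp).mpr hℓb).symm
  have hu0 : u ≠ 0 := hu.ne_zero
  have hut : IsUnit ((t : ℕ) : ZMod ℓ) :=
    (ZMod.isUnit_iff_coprime t ℓ).mpr ((Nat.Prime.coprime_iff_not_dvd hℓp).mpr hℓt).symm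
  have ht0 : ((t : ℕ) : ZMod ℓ) ≠ 0 := hut.ne_zero
  have hu'0 : (t : ZMod ℓ) * u ≠ 0 := mul_ne_zero ht0 hu0
  -- the weight, its translate, and their vanishing at `0`
  set w : ZMod ℓ → ℤ := loopWeight t u with hwdef
  set θw : ZMod ℓ → ℤ := eulerShiftList a L w with hθwdef
  have hw0 : w 0 = 0 := loopWeight_apply_zero t hu0 hu'0
  have hθw0 : θw 0 = 0 := eulerShiftList_apply_zero a L w hw0
  set z : ℂ := ∑ x : ZMod ℓ, (θw x : ℂ) * cuspValue f ℓ x with hzdef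
  -- the class `P` and the combination `c`
  set P : DirichletCharacter ℂ ℓ → Prop := fun χ => χ.Even ∧ χ (t : ZMod ℓ) ≠ 1 with hPdef
  set c : DirichletCharacter ℂ ℓ → ℂ :=
    fun χ => χ ((t : ZMod ℓ) * u)⁻¹ + χ (-((t : ZMod ℓ) * u))⁻¹ - χ u⁻¹ - χ (-u)⁻¹ with hcdef
  have hcI : ∀ χ, P χ → IsIntegral ℤ (c χ) := by
    intro χ _
    simp only [hcdef]
    exact ((isIntegral_apply χ _).add (isIntegral_apply χ _)).sub (isIntegral_apply χ _)
      |>.sub (isIntegral_apply χ _)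
  have hc0 : ∀ χ, ¬ P χ → c χ = 0 := by
    intro χ hP
    by_cases hev : χ.Even
    · have h1 : χ (t : ZMod ℓ) = 1 := by
        by_contra h; exact hP ⟨hev, h⟩
      have h1' : χ (t : ZMod ℓ)⁻¹ = 1 := by
        have h := map_mul χ ((t : ZMod ℓ)⁻¹) (t : ZMod ℓ)
        rw [inv_mul_cancel₀ ht0, map_one, h1, mul_one] at h
        exact h.symm
      simp only [hcdef]
      rw [show -((t : ZMod ℓ) * u) = (t : ZMod ℓ) * (-u) by ring, mul_inv, mul_inv, map_mul, map_mul,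
        h1', one_mul, one_mul]
      ring
    · have hodd : χ (-1) = -1 := apply_neg_one_eq_neg_one_of_not_even hev
      simp only [hcdef]
      rw [← neg_inv, ← neg_inv, neg_eq_neg_one_mul (((t : ZMod ℓ) * u)⁻¹), neg_eq_neg_one_mul (u⁻¹),
        map_mul, map_mul, hodd]
      ring
  -- `c` as the symmetrised weighted character sum of `w`
  have hcw : ∀ χ : DirichletCharacter ℂ ℓ,
      c χ = (∑ x : ZMod ℓ, (w x : ℂ) * χ x⁻¹) + ∑ x : ZMod ℓ, (w x : ℂ) * χ (-x)⁻¹ := by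
    intro χ
    rw [hwdef, sum_loopWeight_mul t u (fun x => χ x⁻¹), sum_loopWeight_mul t u (fun x => χ (-x)⁻¹)]
    simp only [hcdef]
    ring
  -- ORTHOGONALITY with the Euler factor
  have hE : (ℓ.totient : ℂ) * ((j : ℂ) * (plusPeriod f : ℂ))
      = ∑ χ : DirichletCharacter ℂ ℓ, c χ * (eulerFactorList a L χ * twistedSymbolSum f χ) := by
    -- term 1
    have t1 : ∑ χ : DirichletCharacter ℂ ℓ,
        (∑ x : ZMod ℓ, (w x : ℂ) * χ x⁻¹) * (eulerFactorList a L χ * twistedSymbolSum f χ)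
        = (ℓ.totient : ℂ) * z := by
      have : ∀ χ : DirichletCharacter ℂ ℓ,
          (∑ x : ZMod ℓ, (w x : ℂ) * χ x⁻¹) * (eulerFactorList a L χ * twistedSymbolSum f χ)
            = (∑ x : ZMod ℓ, (θw x : ℂ) * χ x⁻¹) * twistedSymbolSum f χ := by
        intro χ
        rw [← mul_assoc, weightChar_mul_eulerFactorList a χ L w hLne]
      simp_rw [this]
      exact sum_weightChar_mul_twistedSymbolSum f θw hθw0
    -- term 2
    have t2 : ∑ χ : DirichletCharacter ℂ ℓ,
        (∑ x : ZMod ℓ, (w x : ℂ) * χ (-x)⁻¹) * (eulerFactorList a L χ * twistedSymbolSum f χ)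
        = (ℓ.totient : ℂ) * conj z := by
      have hneg : ∀ χ : DirichletCharacter ℂ ℓ,
          ∑ x : ZMod ℓ, (w x : ℂ) * χ (-x)⁻¹ = ∑ y : ZMod ℓ, ((w (-y) : ℤ) : ℂ) * χ y⁻¹ := by
        intro χ
        rw [← sum_reindex_neg (fun x => (w x : ℂ) * χ (-x)⁻¹)]
        refine Finset.sum_congr rfl (fun y _ => ?_)
        simp only [neg_neg]
      have hcomm : ∀ χ : DirichletCharacter ℂ ℓ,
          ∑ x : ZMod ℓ, ((eulerShiftList a L (fun y => w (-y)) x : ℤ) : ℂ) * χ x⁻¹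
            = ∑ x : ZMod ℓ, ((θw (-x) : ℤ) : ℂ) * χ x⁻¹ := by
        intro χ
        refine Finset.sum_congr rfl (fun x _ => ?_)
        rw [eulerShiftList_neg a L w x]
      have : ∀ χ : DirichletCharacter ℂ ℓ,
          (∑ x : ZMod ℓ, (w x : ℂ) * χ (-x)⁻¹) * (eulerFactorList a L χ * twistedSymbolSum f χ)
            = (∑ x : ZMod ℓ, ((θw (-x) : ℤ) : ℂ) * χ x⁻¹) * twistedSymbolSum f χ := by
        intro χ
        rw [← mul_assoc, hneg χ, weightChar_mul_eulerFactorList a χ L _ hLne, hcomm χ]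
      simp_rw [this]
      rw [sum_weightChar_mul_twistedSymbolSum f (fun x => θw (-x)) (by simpa using hθw0)]
      congr 1
      rw [← sum_reindex_neg (fun x => ((θw (-x) : ℤ) : ℂ) * cuspValue f ℓ x)]
      simp only [neg_neg]
      rw [hzdef, map_sum]
      refine Finset.sum_congr rfl (fun y _ => ?_)
      rw [map_mul, map_intCast, cuspValue_neg f hreal]
    simp_rw [hcw, add_mul, Finset.sum_add_distrib]
    rw [t1, t2, ← mul_add, hgj]
  obtain ⟨χ, ⟨hev, hχt⟩, hunit⟩ :=
    exists_unit_of_fourier_family f h3tot hΩC (fun χ => eulerFactorList a L χ * twistedSymbolSum f χ)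
      P c hcI hc0 hj3 hE
  have hne : χ ≠ 1 := by
    rintro rfl
    exact hχt (MulChar.one_apply hut)
  refine ⟨ℓ, inferInstance, hℓp, hℓ3, hℓtN, hℓL, χ,
    eulerFactorList a L χ * twistedSymbolSum f χ / (plusPeriod f : ℂ), hcop,
    isPrimitive_of_ne_one_prime hℓp hne, hne, ?_, hχt, hev, by field_simp, hunit⟩
  intro h3
  apply h3tot
  have := Int.natCast_dvd_natCast.mpr (h3.trans (orderOf_dvd_sub_one_prime hℓp χ))
  rwa [Nat.totient_prime hℓp]

end EulerUnitTwist

end Summit.BirchSwinnertonDyer.Rank1Residual.ManinAdditive.KatoCurve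

end
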